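import Literature.NumberTheory.LFunctions.Zhang2022.DHChainBarrier
import Literature.NumberTheory.LFunctions.Zhang2022.DHMenuLines
import HarnessLib

/-!
# B-DH-W, the value / repulsion / window rows: the conjuncts of `Zhang2022.DH.MenuConsistent` that
# the (A)-world `W(D, χ)` meets by the real-inequality LINES of `DHMenuLines` (cell `landau-siegel`,
# family B-dh, KILL certificate; ls-Bdh-plan GO 2026-08-26T18:19:57Z)

Topic `Literature/NumberTheory/LFunctions/Zhang2022` (namespace `Literature.NumberTheory.LFunctions.Zhang2022.DH`,
next to `DHChainBarrier.lean` = the statement `MenuConsistent` of ls-Bdh-typer-2 and `DHMenuLines.lean` = the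
arithmetic lines of ls-Bdh-typer-1). Everything here is PROVED; no named fact, no `L`-function.

What is proved. For the (A)-world `world D χ` of `DHChainBarrier.lean` (`log D ≥ 43 250`, `χ` primitive
quadratic, `χ ≠ χ₀` where a row needs it) we discharge, FIELD BY FIELD and with the field's statement copied
verbatim, the rows of `ZeroWorld.Menu (world D χ) D χ` whose content on the world is a real inequality between
`λ(D) = ½(log D)⁻²⁰²²`, `δ(D) = 1 − β₁(D) = λ/0.75` and an explicit function of the modulus — or is VACUOUS because
the world has no zero with `Re ρ > ½` other than `β₁(D)` (the structural lemma `re_gt_half_zero`):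
`world_row01` (BGTZ Cor. 1.1 — vacuous), `world_row02` (BGTZ Thm. 1.3 — vacuous), `world_row03` (the two
half-line value rows, `Lhalf ≡ 1`), `world_row08` (McCurley's at-most-one-zero region and Lu–Zaman–Zhao: only
`β₁(D)` lies in the region), `world_row09` (Lemma 2.9's window = `DHMenuLines.lemma29_window` /
`lemma29_sides_at_world`), `world_row10` (Bordignon's and the kernel's Page-type floors = `bordignon_lt_delta`,
`tree80_lt_delta`), `world_row11` (`‖L(1,ψ)‖ ≤ log q`), `world_row12` (the exceptional-zero package at `(D, χ)`
with `β₁ = betaExc D`), `world_row15` (the `0.69/√q` floor = `floor069_lt_lam`), `world_row19` (the GRH row is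
inert: `β₁(D)` is off the line), `world_rowS3` (positivity / conjugation of the value field). Together with
typer-2's `world_assumptionA` this leaves for §E exactly the FENCE rows (`row04`, `row05`, `row06`, `row13`,
`rowS1`, `rowS2`, `rowS4`: Riemann–von Mangoldt counting on the picket fence and `β₁(Q)` of the family).

Method: `(world D χ).IsZero q ψ ρ ↔ ρ ∈ fence ψ.conductor ∨ (IsExcSlot D χ q ψ ∧ ρ ∈ {β₁, 1 − β₁})`
(`isZero_world_iff`); fence points have `Re ρ = ½` (`fence_re`), `1 − β₁ = δ(log D) < ½ < β₁`
(`DHMenuLines.window`); so a zero with `Re ρ > ½` is `β₁(D)` on an induced slot `D ∣ q` (`re_gt_half_zero`),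
where `q ≥ D`, `log q ≥ log D`, `√q ≥ √D = e^{(log D)/2}` turn each row into a line of `DHMenuLines` at
`L = log D`.

WHAT THIS IS NOT: not a proof of `MenuConsistent` (the fence rows remain, → §E); no statement about any actual
`L`-function; no verdict. «The programme SEARCHES and TYPES; no claim about Landau–Siegel zeros, Theorems 1–2
of arXiv:2211.02515 or a repaired Margin232 until a kernel theorem says so.»

## References

* `pub/landau-siegel/B-dh/KILL-draft.md` v1.2 §2–§3, `B-dh/EDLIST.md` v1.2 (rows dhE-01…dhE-24).
* [Zhang2022LandauSiegel] §2 Assumption (A); [BenliGoelTwissZaman2025] Cor. 1.1, Thm. 1.3, Lemma 2.9, Thm. 2.8;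
  [McCurley1984ZFR] Thm. 1; [MontgomeryVaughan2007] §4.3, §11.2; [LamzouriLiSoundararajan2015] Thm. 1.5.
-/

noncomputable section

open scoped Classical
open Complex

namespace Literature.NumberTheory.LFunctions.Zhang2022.DH

/-! ### 1. Bridge to `DHMenuLines` and the numerics of the world at `log D ≥ 43 250` -/

/-- `λ(D)` of the world is `DHMenuLines.lam (log D)`. [cite: Zhang2022LandauSiegel, §2 Assumption (A)] -/
theorem lam_eq_lines (D : ℕ) : lam D = DHMenuLines.lam (Real.log D) := rfl

/-- `1 − β₁(D) = δ(log D) = λ/0.75`. [cite: BenliGoelTwissZaman2025, Lemma 2.9] -/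
theorem one_sub_betaExc (D : ℕ) : 1 - betaExc D = DHMenuLines.delta (Real.log D) := by
  rw [betaExc, DHMenuLines.delta_eq_lam_div, lam_eq_lines]; ring

/-- `log 3 > 1` (`e < 2.72 < 3`). [cite: MontgomeryVaughan2007, §4.3] -/
private theorem one_lt_log_three : (1 : ℝ) < Real.log 3 := by
  rw [Real.lt_log_iff_exp_lt (by norm_num)]
  exact lt_trans Real.exp_one_lt_d9 (by norm_num)

/-- `log 10 ≥ 2` (`e² < 7.39 < 10`). [cite: MontgomeryVaughan2007, §4.3] -/
private theorem two_le_log_ten : (2 : ℝ) ≤ Real.log 10 := by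
  rw [Real.le_log_iff_exp_le (by norm_num)]
  have h : Real.exp 2 = Real.exp 1 ^ 2 := by rw [← Real.exp_nat_mul]; norm_num
  rw [h]
  nlinarith [Real.exp_one_lt_d9, Real.exp_pos 1]

/-- `e^{24} > 10^{10}` (`e³ > 20`, `20⁸ = 2.56·10¹⁰`). [cite: MontgomeryVaughan2007, §4.3] -/
private theorem exp_24_gt : (10 : ℝ) ^ 10 < Real.exp 24 := by
  have h3 : (20 : ℝ) < Real.exp 3 := by
    have h : Real.exp 3 = Real.exp 1 ^ 3 := by rw [← Real.exp_nat_mul]; norm_num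
    rw [h]
    calc (20 : ℝ) < 2.7182818283 ^ 3 := by norm_num
      _ ≤ Real.exp 1 ^ 3 := pow_le_pow_left₀ (by norm_num) Real.exp_one_gt_d9.le 3
  have h24 : Real.exp 24 = Real.exp 3 ^ 8 := by rw [← Real.exp_nat_mul]; norm_num
  rw [h24]
  calc (10 : ℝ) ^ 10 < 20 ^ 8 := by norm_num
    _ ≤ Real.exp 3 ^ 8 := pow_le_pow_left₀ (by norm_num) h3.le 8

section Numerics

variable {D : ℕ} (hL : (43250 : ℝ) ≤ Real.log D)
include hL

/-- `log D > 0`. [cite: Zhang2022LandauSiegel, §2 (2.1)] -/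
theorem log_pos_of_hL : 0 < Real.log (D : ℝ) := by linarith

/-- `D > 0` as a real number. [cite: Zhang2022LandauSiegel, §2 (2.1)] -/
theorem cast_pos_of_hL : (0 : ℝ) < D := by
  have h : (D : ℝ) ≠ 0 := by
    intro h; rw [h, Real.log_zero] at hL; linarith
  exact lt_of_le_of_ne (Nat.cast_nonneg D) (Ne.symm h)

/-- `D = e^{log D} ≥ e^{24} > 10¹⁰`. [cite: Zhang2022LandauSiegel, §2 (2.1)] -/
theorem ten_pow_ten_lt_of_hL : (10 : ℝ) ^ 10 < D := by
  have h1 : Real.exp 24 ≤ Real.exp (Real.log D) := Real.exp_le_exp.mpr (by linarith)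
  rw [Real.exp_log (cast_pos_of_hL hL)] at h1
  exact lt_of_lt_of_le exp_24_gt h1

/-- `D > 4·10⁵`. [cite: BenliGoelTwissZaman2025, Corollary 1.1] -/
theorem nat_400000_lt_of_hL : 400000 < D := by
  have h := ten_pow_ten_lt_of_hL hL
  exact_mod_cast (show (400000 : ℝ) < D by linarith)

/-- `D ≥ 3`. [cite: Zhang2022LandauSiegel, §2 (2.1)] -/
theorem three_le_of_hL : 3 ≤ D := le_of_lt (lt_trans (by norm_num) (nat_400000_lt_of_hL hL))

/-- `√D = e^{(log D)/2}`. [cite: MontgomeryVaughan2007, §4.3] -/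
theorem sqrt_cast_eq_exp : Real.sqrt (D : ℝ) = Real.exp (Real.log D / 2) := by
  have h : Real.exp (Real.log D / 2) ^ 2 = D := by
    rw [← Real.exp_nat_mul, Nat.cast_ofNat, mul_div_cancel₀ _ (two_ne_zero), Real.exp_log (cast_pos_of_hL hL)]
  have h2 : Real.sqrt (Real.exp (Real.log D / 2) ^ 2) = Real.exp (Real.log D / 2) :=
    Real.sqrt_sq (Real.exp_pos _).le
  rwa [h] at h2

/-- `D^{1/2} = e^{(log D)/2}` (real power). [cite: MontgomeryVaughan2007, §4.3] -/
theorem rpow_half_cast_eq_exp : (D : ℝ) ^ ((1 : ℝ) / 2) = Real.exp (Real.log D / 2) := by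
  rw [Real.rpow_def_of_pos (cast_pos_of_hL hL)]; ring_nf

/-- The window of the world's exceptional zero: `1 − 1/(10 log D) < β₁(D) < 1`.
[cite: BenliGoelTwissZaman2025, Corollary 1.1] -/
theorem betaExc_window : 1 - 1 / (10 * Real.log D) < betaExc D ∧ betaExc D < 1 := by
  have h := DHMenuLines.window hL
  rw [← one_sub_betaExc] at h
  constructor <;> linarith [h.1, h.2]

/-- `β₁(D) > ½`. [cite: BenliGoelTwissZaman2025, Corollary 1.1] -/
theorem half_lt_betaExc : (1 : ℝ) / 2 < betaExc D := by
  have h := (betaExc_window hL).1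
  have hl : 0 < Real.log (D : ℝ) := log_pos_of_hL hL
  have : 1 / (10 * Real.log D) ≤ 1 / (10 * 43250) :=
    div_le_div_of_nonneg_left (by norm_num) (by norm_num) (by linarith)
  linarith [this]

/-- `1 − β₁(D) < ½`. [cite: BenliGoelTwissZaman2025, Corollary 1.1] -/
theorem one_sub_betaExc_lt_half : 1 - betaExc D < 1 / 2 := by linarith [half_lt_betaExc hL]

/-- `λ(D) ≤ 1`. [cite: Zhang2022LandauSiegel, §2 Assumption (A)] -/
theorem lam_le_one : lam D ≤ 1 := by
  have hl : 1 ≤ Real.log (D : ℝ) := by linarith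
  unfold lam
  have hp : 1 ≤ Real.log (D : ℝ) ^ 2022 := one_le_pow₀ hl
  rw [div_le_one (by positivity)]
  linarith

/-- `λ(D) > 0`. [cite: Zhang2022LandauSiegel, §2 Assumption (A)] -/
theorem lam_pos_of_hL : 0 < lam D := by
  rw [lam_eq_lines]; exact DHMenuLines.lam_pos (log_pos_of_hL hL)

end Numerics

/-! ### 2. The world's data, unfolded -/

section World

variable {D : ℕ} {χ : DirichletCharacter ℂ D}

/-- The multiplicity field of `world D χ`. [cite: Zhang2022LandauSiegel, §2 Assumption (A)] -/
theorem world_mult (q : ℕ) (ψ : DirichletCharacter ℂ q) (ρ : ℂ) :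
    (world D χ).mult q ψ ρ =
      (if ρ ∈ fence ψ.conductor then 1 else 0) + (if IsExcSlot D χ q ψ ∧ ρ ∈ excPair D then 1 else 0) := rfl

/-- The value field of `world D χ`. [cite: Zhang2022LandauSiegel, §2 Assumption (A)] -/
theorem world_LOne (q : ℕ) (ψ : DirichletCharacter ℂ q) :
    (world D χ).LOne q ψ = if IsExcSlot D χ q ψ then lam D else 1 := rfl

/-- The half-line field of `world D χ` is `≡ 1`. [cite: BenliGoelTwissZaman2025, Hypothesis 2.1] -/
theorem world_Lhalf (q : ℕ) (ψ : DirichletCharacter ℂ q) (t : ℝ) : (world D χ).Lhalf q ψ t = 1 := rfl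

/-- The zeros of `world D χ`: fence points of the conductor, plus the exceptional pair on induced slots.
[cite: Zhang2022LandauSiegel, §2 Assumption (A)] -/
theorem isZero_world_iff {q : ℕ} {ψ : DirichletCharacter ℂ q} {ρ : ℂ} :
    (world D χ).IsZero q ψ ρ ↔ ρ ∈ fence ψ.conductor ∨ (IsExcSlot D χ q ψ ∧ ρ ∈ excPair D) := by
  unfold ZeroWorld.IsZero
  rw [world_mult]
  by_cases h1 : ρ ∈ fence ψ.conductor <;> by_cases h2 : (IsExcSlot D χ q ψ ∧ ρ ∈ excPair D) <;>
    simp [h1, h2]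

/-- Fence points lie on the critical line. [cite: BennettMartinOBryantRechnitzer2021, Theorem 1.1] -/
theorem fence_re {f : ℕ} {ρ : ℂ} (h : ρ ∈ fence f) : ρ.re = 1 / 2 := by
  rcases h with ⟨n, rfl⟩ | ⟨n, rfl⟩ <;> simp

/-- Membership in the exceptional pair. [cite: Zhang2022LandauSiegel, §2 Assumption (A)] -/
theorem mem_excPair_iff {ρ : ℂ} :
    ρ ∈ excPair D ↔ ρ = ((betaExc D : ℝ) : ℂ) ∨ ρ = ((1 - betaExc D : ℝ) : ℂ) := by
  show ρ ∈ ({((betaExc D : ℝ) : ℂ), ((1 - betaExc D : ℝ) : ℂ)} : Set ℂ) ↔ _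
  rw [Set.mem_insert_iff, Set.mem_singleton_iff]

/-- An induced slot has `D ∣ q`, so `D ≤ q`. [cite: MontgomeryVaughan2007, §9.1] -/
theorem IsExcSlot.cast_le {q : ℕ} [NeZero q] {ψ : DirichletCharacter ℂ q} (h : IsExcSlot D χ q ψ) :
    (D : ℝ) ≤ q := by
  obtain ⟨hd, -⟩ := h
  exact_mod_cast Nat.le_of_dvd (Nat.pos_of_ne_zero (NeZero.ne q)) hd

/-- An induced slot `ψ` has conductor `cond χ`; if `χ` is primitive, conductor `D`.
[cite: MontgomeryVaughan2007, §9.1] -/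
theorem IsExcSlot.conductor_eq {q : ℕ} [NeZero q] {ψ : DirichletCharacter ℂ q} (h : IsExcSlot D χ q ψ)
    (hprim : χ.IsPrimitive) : ψ.conductor = D := by
  obtain ⟨hd, rfl⟩ := h
  rw [DirichletCharacter.conductor_changeLevel χ hd]
  exact hprim

/-- A PRIMITIVE induced slot is the slot `(D, χ)` itself: `q = D`. [cite: MontgomeryVaughan2007, §9.1] -/
theorem IsExcSlot.level_eq {q : ℕ} [NeZero q] {ψ : DirichletCharacter ℂ q} (h : IsExcSlot D χ q ψ)
    (hprim : χ.IsPrimitive) (hψ : ψ.IsPrimitive) : q = D := by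
  have h1 := h.conductor_eq hprim
  rw [DirichletCharacter.isPrimitive_def] at hψ
  rw [hψ] at h1
  exact h1

/-- The slot `(D, χ)` is induced (from itself). [cite: MontgomeryVaughan2007, §9.1] -/
theorem isExcSlot_self : IsExcSlot D χ D χ := ⟨dvd_rfl, (DirichletCharacter.changeLevel_self χ).symm⟩

/-- Two induced slots of the same level carry the same character. [cite: MontgomeryVaughan2007, §9.1] -/
theorem IsExcSlot.eq_of_eq {q : ℕ} {ψ ψ' : DirichletCharacter ℂ q} (h : IsExcSlot D χ q ψ)
    (h' : IsExcSlot D χ q ψ') : ψ = ψ' := by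
  obtain ⟨hd, rfl⟩ := h
  obtain ⟨hd', rfl⟩ := h'
  rfl

/-- An induced slot at level `D` is `χ`. [cite: MontgomeryVaughan2007, §9.1] -/
theorem IsExcSlot.eq_self {ψ : DirichletCharacter ℂ D} (h : IsExcSlot D χ D ψ) : ψ = χ :=
  h.eq_of_eq isExcSlot_self

/-- Induced slots are stable under `ψ ↦ ψ⁻¹` when `χ` is quadratic. [cite: MontgomeryVaughan2007, §9.1] -/
theorem isExcSlot_inv_iff (hquad : χ.IsQuadratic) {q : ℕ} {ψ : DirichletCharacter ℂ q} :
    IsExcSlot D χ q ψ⁻¹ ↔ IsExcSlot D χ q ψ := by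
  constructor
  · rintro ⟨hd, h⟩
    refine ⟨hd, ?_⟩
    rw [inv_eq_iff_eq_inv, ← map_inv, hquad.inv] at h
    exact h
  · rintro ⟨hd, h⟩
    refine ⟨hd, ?_⟩
    rw [h, ← map_inv, hquad.inv]

/-- A window `1 − 1/(10 log q) < β` with `q ≥ 3` forces `β > ½`. [cite: BenliGoelTwissZaman2025, Corollary 1.1] -/
theorem half_lt_of_window {q : ℕ} (hq : 3 ≤ q) {β : ℝ} (h : 1 - 1 / (10 * Real.log q) < β) : 1 / 2 < β := by
  have hq3 : (3 : ℝ) ≤ q := by exact_mod_cast hq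
  have hlog : 1 < Real.log (q : ℝ) := lt_of_lt_of_le one_lt_log_three (Real.log_le_log (by norm_num) hq3)
  have : 1 / (10 * Real.log q) ≤ 1 / (10 * 1) :=
    div_le_div_of_nonneg_left (by norm_num) (by norm_num) (by linarith)
  linarith

variable (hL : (43250 : ℝ) ≤ Real.log D)
include hL

/-- **The structural lemma.** A zero of the world with `Re ρ > ½` is the exceptional zero `β₁(D)` on an induced
slot. [cite: Zhang2022LandauSiegel, §2 Assumption (A)] -/
theorem re_gt_half_zero {q : ℕ} {ψ : DirichletCharacter ℂ q} {ρ : ℂ} (hz : (world D χ).IsZero q ψ ρ)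
    (hre : 1 / 2 < ρ.re) : IsExcSlot D χ q ψ ∧ ρ = ((betaExc D : ℝ) : ℂ) := by
  rw [isZero_world_iff] at hz
  rcases hz with hf | ⟨hs, hp⟩
  · exact absurd (fence_re hf) (ne_of_gt hre)
  · rw [mem_excPair_iff] at hp
    rcases hp with rfl | rfl
    · exact ⟨hs, rfl⟩
    · exfalso
      rw [Complex.ofReal_re] at hre
      linarith [one_sub_betaExc_lt_half hL]

/-- Real-zero form: a real zero `β > ½` of the world is `β₁(D)` on an induced slot.
[cite: Zhang2022LandauSiegel, §2 Assumption (A)] -/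
theorem real_zero_gt_half {q : ℕ} {ψ : DirichletCharacter ℂ q} {β : ℝ} (hz : (world D χ).IsZero q ψ β)
    (hβ : 1 / 2 < β) : IsExcSlot D χ q ψ ∧ β = betaExc D := by
  obtain ⟨hs, h⟩ := re_gt_half_zero hL hz (by rwa [Complex.ofReal_re])
  exact ⟨hs, by exact_mod_cast h⟩

/-- `β₁(D)` IS a zero of the slot `(D, χ)`, with multiplicity one. [cite: Zhang2022LandauSiegel, §2 Assumption (A)] -/
theorem mult_self_betaExc : (world D χ).mult D χ ((betaExc D : ℝ) : ℂ) = 1 := by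
  rw [world_mult]
  have hnf : ((betaExc D : ℝ) : ℂ) ∉ fence χ.conductor := by
    intro hf
    have := fence_re hf
    rw [Complex.ofReal_re] at this
    linarith [half_lt_betaExc hL]
  have hp : ((betaExc D : ℝ) : ℂ) ∈ excPair D := by rw [mem_excPair_iff]; left; rfl
  rw [if_neg hnf, if_pos ⟨isExcSlot_self, hp⟩]

/-! ### 3. The rows -/

/-- **Row dhE-01 on the world (BGTZ Cor. 1.1): VACUOUS** — a zero `ρ ≠ β₁` with `Re ρ > ½` does not exist in
`W(D, χ)`. [cite: BenliGoelTwissZaman2025, Corollary 1.1] -/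
theorem world_row01 : ∀ (q : ℕ) [NeZero q], 400000 < q → ∀ T : ℝ, 4 ≤ T →
    ∀ (χ₁ : DirichletCharacter ℂ q) (β₁ : ℝ), 1 - 1 / (10 * Real.log q) < β₁ → β₁ < 1 →
      (world D χ).IsZero q χ₁ β₁ →
      ∀ (ψ : DirichletCharacter ℂ q) (ρ : ℂ), ρ ≠ 1 → ρ ≠ (β₁ : ℂ) → (world D χ).IsZero q ψ ρ →
        1 / 2 < ρ.re → |ρ.im| ≤ T → ρ.re < BGTZ2025.repulsionBound 10 1 107 (1 / 16) q T β₁ := by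
  intro q _ hq T _ χ₁ β₁ hlo _ hz1 ψ ρ _ hρβ hz hre _
  exfalso
  obtain ⟨-, rfl⟩ := re_gt_half_zero hL hz hre
  obtain ⟨-, h⟩ := real_zero_gt_half hL hz1 (half_lt_of_window (by omega) hlo)
  exact hρβ (by rw [h])

/-- **Row dhE-02 on the world (BGTZ Thm. 1.3): VACUOUS** for the same reason. [cite: BenliGoelTwissZaman2025, Theorem 1.3] -/
theorem world_row02 : ∀ (q : ℕ) [NeZero q], 400000 < q → ∀ T : ℝ, 4 ≤ T →
    ∀ A B θ ε : ℝ, 1 ≤ A → 1 ≤ B → 0 < θ → θ ≤ 1 / 4 → 0 < ε → ε ≤ 1 / 2 → (world D χ).hypothesisA A θ →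
      ∀ (χ₁ : DirichletCharacter ℂ q) (β₁ : ℝ), 1 - 1 / (10 * Real.log q) < β₁ →
        β₁ < 1 - B / ((q : ℝ) ^ ε * Real.log q ^ 2) → (world D χ).IsZero q χ₁ β₁ →
          ∀ (ψ : DirichletCharacter ℂ q) (ρ : ℂ), ρ ≠ 1 → ρ ≠ (β₁ : ℂ) → (world D χ).IsZero q ψ ρ →
            1 / 2 < ρ.re → |ρ.im| ≤ T →
            ρ.re < 1 - Real.log (θ / (4 * (1 - β₁) * Real.log (BGTZ2025.theorem13M A B θ ε q T))) /
              Real.log (BGTZ2025.theorem13M A B θ ε q T) := by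
  intro q _ hq T _ A B θ ε _ _ _ _ _ _ _ χ₁ β₁ hlo _ hz1 ψ ρ _ hρβ hz hre _
  exfalso
  obtain ⟨-, rfl⟩ := re_gt_half_zero hL hz hre
  obtain ⟨-, h⟩ := real_zero_gt_half hL hz1 (half_lt_of_window (by omega) hlo)
  exact hρβ (by rw [h])

omit hL in
/-- **Row dhE-03 on the world (half-line value rows)**: `Lhalf ≡ 1 ≤ 2.97655 (q(1+|t|))^{1/4}` and
`1 ≤ 0.918 q^{3/16} (log q)^{3/2} |½ + it|` for prime `q ≥ 10¹⁰`, `|t| ≥ 1`.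
[cite: BenliGoelTwissZaman2025, Proposition 2.4] [cite: Francis2022Thesis, Theorem 4.4.2] -/
theorem world_row03 : (world D χ).hypothesisA 2.97655 (1 / 4) ∧
    ∀ (q : ℕ) [NeZero q], q.Prime → 10 ^ 10 ≤ q → ∀ ψ : DirichletCharacter ℂ q, ψ ≠ 1 → ψ.IsPrimitive →
      ∀ t : ℝ, 1 ≤ |t| → (world D χ).Lhalf q ψ t ≤ Francis2022.boundHalf q t := by
  constructor
  · intro q _ ψ _ t
    rw [world_Lhalf]
    have hq1 : (1 : ℝ) ≤ q := by exact_mod_cast Nat.one_le_iff_ne_zero.mpr (NeZero.ne q)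
    have hbase : (1 : ℝ) ≤ (q : ℝ) * (1 + |t|) := by nlinarith [abs_nonneg t]
    have hr : (1 : ℝ) ≤ ((q : ℝ) * (1 + |t|)) ^ ((1 : ℝ) / 4) := by
      calc (1 : ℝ) = 1 ^ ((1 : ℝ) / 4) := (Real.one_rpow _).symm
        _ ≤ ((q : ℝ) * (1 + |t|)) ^ ((1 : ℝ) / 4) := Real.rpow_le_rpow (by norm_num) hbase (by norm_num)
    nlinarith
  · intro q _ _ hq ψ _ _ t ht
    rw [world_Lhalf]
    unfold Francis2022.boundHalf
    have hq10 : (10 : ℝ) ^ 10 ≤ q := by exact_mod_cast hq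
    have hq1 : (1 : ℝ) ≤ q := le_trans (by norm_num) hq10
    have hA : (1 : ℝ) ≤ (q : ℝ) ^ ((3 : ℝ) / 16) := by
      calc (1 : ℝ) = 1 ^ ((3 : ℝ) / 16) := (Real.one_rpow _).symm
        _ ≤ (q : ℝ) ^ ((3 : ℝ) / 16) := Real.rpow_le_rpow (by norm_num) hq1 (by norm_num)
    have hlog : (20 : ℝ) ≤ Real.log q := by
      have h1 : Real.log ((10 : ℝ) ^ 10) ≤ Real.log q := Real.log_le_log (by positivity) hq10
      rw [Real.log_pow] at h1
      push_cast at h1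
      linarith [two_le_log_ten]
    have hB : (20 : ℝ) ≤ Real.log q ^ ((3 : ℝ) / 2) := by
      refine le_trans hlog ?_
      conv_lhs => rw [← Real.rpow_one (Real.log q)]
      exact Real.rpow_le_rpow_of_exponent_le (by linarith) (by norm_num)
    have hC : (1 : ℝ) ≤ ‖(1 / 2 : ℂ) + t * I‖ := by
      refine le_trans ht ?_
      have := Complex.abs_im_le_norm ((1 / 2 : ℂ) + t * I)
      simpa using this
    calc (1 : ℝ) ≤ 0.918 * 1 * 20 * 1 := by norm_num
      _ ≤ 0.918 * (q : ℝ) ^ ((3 : ℝ) / 16) * Real.log q ^ ((3 : ℝ) / 2) * ‖(1 / 2 : ℂ) + t * I‖ := by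
          gcongr

/-- **Row dhE-08 on the world (McCurley's at-most-one zero; Lu–Zaman–Zhao)**: the only zeros in McCurley's region
are `β₁(D)` on the induced slots of ONE character `changeLevel χ` per level; no zero `σ ≥ 1 − 1/(5 log q)` at
levels `q ≤ 10¹⁰ < D`. [cite: McCurley1984ZFR, Theorem 1] [cite: LuZamanZhao2026, Theorem 1.1] -/
theorem world_row08 (hχ : χ ≠ 1) (hquad : χ.IsQuadratic) :
    (∀ (q : ℕ) [NeZero q], 3 ≤ q → ∀ (χ₁ χ₂ : DirichletCharacter ℂ q) (s₁ s₂ : ℂ), s₁ ≠ 1 → s₂ ≠ 1 →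
      1 - 1 / (9.645908801 * Real.log (max (max (q : ℝ) ((q : ℝ) * |s₁.im|)) 10)) < s₁.re →
      1 - 1 / (9.645908801 * Real.log (max (max (q : ℝ) ((q : ℝ) * |s₂.im|)) 10)) < s₂.re →
        (world D χ).IsZero q χ₁ s₁ → (world D χ).IsZero q χ₂ s₂ →
          (χ₁ = χ₂ ∧ s₁ = s₂) ∧ s₁.im = 0 ∧ χ₁ ≠ 1 ∧ χ₁ ^ 2 = 1) ∧
    (∀ (q : ℕ) [NeZero q], q ≤ 10 ^ 10 → ∀ ψ : DirichletCharacter ℂ q, ψ.IsQuadratic → ψ ≠ 1 →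
      ∀ σ : ℝ, 1 - 1 / (5 * Real.log q) ≤ σ → ¬ (world D χ).IsZero q ψ σ) := by
  -- McCurley's region lies inside `Re s > 1/2`
  have hregion : ∀ (x : ℝ) (s : ℂ), 1 - 1 / (9.645908801 * Real.log (max x 10)) < s.re → 1 / 2 < s.re := by
    intro x s hs
    have hlog : 2 ≤ Real.log (max x 10) :=
      le_trans two_le_log_ten (Real.log_le_log (by norm_num) (le_max_right _ _))
    have : 1 / (9.645908801 * Real.log (max x 10)) ≤ 1 / (9.645908801 * 2) :=
      div_le_div_of_nonneg_left (by norm_num) (by norm_num) (by nlinarith)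
    have h2 : (1 : ℝ) / (9.645908801 * 2) < 1 / 2 := by norm_num
    linarith
  constructor
  · intro q _ _ χ₁ χ₂ s₁ s₂ _ _ h1 h2 hz1 hz2
    obtain ⟨hs1, rfl⟩ := re_gt_half_zero hL hz1 (hregion _ _ h1)
    obtain ⟨hs2, rfl⟩ := re_gt_half_zero hL hz2 (hregion _ _ h2)
    have h12 : χ₁ = χ₂ := hs1.eq_of_eq hs2
    obtain ⟨hd, hχ₁⟩ := hs1
    refine ⟨⟨h12, rfl⟩, Complex.ofReal_im _, ?_, ?_⟩
    · rw [hχ₁, Ne, DirichletCharacter.changeLevel_eq_one_iff hd]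
      exact hχ
    · rw [hχ₁, ← map_pow, hquad.sq_eq_one, map_one]
  · intro q _ hq ψ _ hne σ hσ hz
    rw [isZero_world_iff] at hz
    rcases hz with hf | ⟨hs, -⟩
    · have hre := fence_re hf
      rw [Complex.ofReal_re] at hre
      -- `q ≥ 2` since `ψ ≠ 1`
      have hq2 : (2 : ℝ) ≤ q := by
        have : q ≠ 1 := by
          rintro rfl
          exact hne (DirichletCharacter.level_one ψ)
        have h0 : q ≠ 0 := NeZero.ne q
        exact_mod_cast (show 2 ≤ q by omega)
      have hlog : 0.6931471803 < Real.log (q : ℝ) :=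
        lt_of_lt_of_le Real.log_two_gt_d9 (Real.log_le_log (by norm_num) hq2)
      have : 1 / (5 * Real.log q) < 1 / (5 * 0.6931471803) :=
        div_lt_div_of_pos_left (by norm_num) (by norm_num) (by nlinarith)
      have h3 : (1 : ℝ) / (5 * 0.6931471803) < 1 / 2 := by norm_num
      linarith
    · have h1 := hs.cast_le
      have h2 : (q : ℝ) ≤ (10 : ℝ) ^ 10 := by exact_mod_cast hq
      linarith [ten_pow_ten_lt_of_hL hL]

/-- **Row dhE-09 on the world (BGTZ Lemma 2.9's window)**: a real zero in the window is `β₁(D)` on an induced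
slot, where `LOne = λ(D)`, and `0.72(1 − β₁) = 0.96λ ≤ λ ≤ 0.18 log²q (1 − β₁)` since `log q ≥ log D ≥ 43250`.
[cite: BenliGoelTwissZaman2025, Lemma 2.9] -/
theorem world_row09 : ∀ (q : ℕ) [NeZero q], 400000 < q → ∀ χ₁ : DirichletCharacter ℂ q, χ₁.IsQuadratic →
    χ₁ ≠ 1 → ∀ β₁ : ℝ, 1 - 1 / (10 * Real.log q) < β₁ → β₁ < 1 → (world D χ).IsZero q χ₁ β₁ →
      0.72 * (1 - β₁) ≤ (world D χ).LOne q χ₁ ∧ (world D χ).LOne q χ₁ ≤ 0.18 * Real.log q ^ 2 * (1 - β₁) := by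
  intro q _ hq χ₁ _ _ β₁ hlo _ hz
  obtain ⟨hs, rfl⟩ := real_zero_gt_half hL hz (half_lt_of_window (by omega) hlo)
  rw [world_LOne, if_pos hs]
  have hDq : Real.log D ≤ Real.log q := Real.log_le_log (cast_pos_of_hL hL) hs.cast_le
  exact lemma29_sides_at_world (log_pos_of_hL hL) (L := Real.log q) (by nlinarith)

/-- **Row dhE-10 on the world (Bordignon's floor; the kernel's `1/(80√q log²q)` floor).**
[cite: BenliGoelTwissZaman2025, Theorem 2.8] [cite: MontgomeryVaughan2007, §11.2 Exercise 4] -/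
theorem world_row10 : (∀ (q : ℕ) [NeZero q], 3 ≤ q → ∀ (ψ : DirichletCharacter ℂ q) (β₁ : ℝ),
      1 - 1 / (10 * Real.log q) < β₁ → β₁ < 1 → (world D χ).IsZero q ψ β₁ →
        β₁ < 1 - 100 / ((q : ℝ) ^ (1 / 2 : ℝ) * Real.log q ^ 2)) ∧
    (∀ (q : ℕ) [NeZero q], 8 ≤ q → ∀ ψ : DirichletCharacter ℂ q, ψ.IsPrimitive → ψ.IsQuadratic →
      ∀ β : ℝ, (world D χ).IsZero q ψ β → 1 / (80 * Real.sqrt q * Real.log q ^ 2) ≤ 1 - β) := by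
  have hD0 := cast_pos_of_hL hL
  have hl0 := log_pos_of_hL hL
  set L := Real.log (D : ℝ) with hLdef
  have hδ : 1 - betaExc D = DHMenuLines.delta L := one_sub_betaExc D
  constructor
  · intro q _ hq ψ β₁ hlo _ hz
    obtain ⟨hs, rfl⟩ := real_zero_gt_half hL hz (half_lt_of_window hq hlo)
    have hDq := hs.cast_le
    have hlogq : L ≤ Real.log q := Real.log_le_log hD0 hDq
    have hrpow : Real.exp (L / 2) ≤ (q : ℝ) ^ ((1 : ℝ) / 2) := by
      rw [← rpow_half_cast_eq_exp hL]
      exact Real.rpow_le_rpow hD0.le hDq (by norm_num)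
    have hE : 0 < Real.exp (L / 2) := Real.exp_pos _
    have hden : Real.exp (L / 2) * L ^ 2 ≤ (q : ℝ) ^ ((1 : ℝ) / 2) * Real.log q ^ 2 := by
      have h2 : L ^ 2 ≤ Real.log q ^ 2 := pow_le_pow_left₀ hl0.le hlogq 2
      exact mul_le_mul hrpow h2 (by positivity) (by positivity)
    have hB := DHMenuLines.bordignon_lt_delta hL
    have hB' : 100 * Real.exp (-(L / 2)) / L ^ 2 = 100 / (Real.exp (L / 2) * L ^ 2) := by
      rw [Real.exp_neg]; field_simp
    rw [hB'] at hB
    have hmono : 100 / ((q : ℝ) ^ ((1 : ℝ) / 2) * Real.log q ^ 2) ≤ 100 / (Real.exp (L / 2) * L ^ 2) :=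
      div_le_div_of_nonneg_left (by norm_num) (by positivity) hden
    linarith
  · intro q _ hq ψ _ _ β hz
    have hq8 : (8 : ℝ) ≤ q := by exact_mod_cast hq
    -- the floor is at most `1/640 < 1/2`
    have hsq : 2 ≤ Real.sqrt (q : ℝ) := by
      rw [show (2 : ℝ) = Real.sqrt 4 by rw [show (4 : ℝ) = 2 ^ 2 by norm_num, Real.sqrt_sq (by norm_num)]]
      exact Real.sqrt_le_sqrt (by linarith)
    have hlog2 : 2 ≤ Real.log (q : ℝ) := by
      have h8 : Real.log 8 ≤ Real.log (q : ℝ) := Real.log_le_log (by norm_num) hq8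
      have : (2 : ℝ) ≤ Real.log 8 := by
        rw [Real.le_log_iff_exp_le (by norm_num)]
        have h : Real.exp 2 = Real.exp 1 ^ 2 := by rw [← Real.exp_nat_mul]; norm_num
        rw [h]; nlinarith [Real.exp_one_lt_d9, Real.exp_pos 1]
      linarith
    have hfloor : 1 / (80 * Real.sqrt q * Real.log q ^ 2) ≤ 1 / 640 := by
      apply div_le_div_of_nonneg_left (by norm_num) (by norm_num)
      nlinarith
    rw [isZero_world_iff] at hz
    rcases hz with hf | ⟨hs, hp⟩
    · have hre := fence_re hf
      rw [Complex.ofReal_re] at hre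
      rw [hre]; linarith
    · rw [mem_excPair_iff] at hp
      rcases hp with h | h
      · have hβ : β = betaExc D := by exact_mod_cast h
        rw [hβ, hδ]
        have hDq := hs.cast_le
        have hlogq : L ≤ Real.log q := Real.log_le_log hD0 hDq
        have hsqrt : Real.exp (L / 2) ≤ Real.sqrt q := by
          rw [← sqrt_cast_eq_exp hL]; exact Real.sqrt_le_sqrt hDq
        have hE : 0 < Real.exp (L / 2) := Real.exp_pos _
        have hden : 80 * Real.exp (L / 2) * L ^ 2 ≤ 80 * Real.sqrt q * Real.log q ^ 2 := by
          have h2 : L ^ 2 ≤ Real.log q ^ 2 := pow_le_pow_left₀ hl0.le hlogq 2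
          have := mul_le_mul hsqrt h2 (by positivity) (by positivity)
          nlinarith
        have hT := DHMenuLines.tree80_lt_delta hL
        have hmono : 1 / (80 * Real.sqrt q * Real.log q ^ 2) ≤ 1 / (80 * Real.exp (L / 2) * L ^ 2) :=
          div_le_div_of_nonneg_left (by norm_num) (by positivity) hden
        linarith
      · have hβ : β = 1 - betaExc D := by exact_mod_cast h
        rw [hβ]
        linarith [half_lt_betaExc hL]

/-- **Row dhE-11 on the world (`‖L(1,ψ)‖ ≤ log q`, `ψ ≠ χ₀`)**: `LOne ∈ {λ, 1} ≤ 1 < log 3 ≤ log q`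
(`ψ ≠ χ₀` forces `q ≥ 3`). [cite: MontgomeryVaughan2007, §4.3] -/
theorem world_row11 : ∀ (q : ℕ) [NeZero q] (ψ : DirichletCharacter ℂ q), ψ ≠ 1 →
    (world D χ).LOne q ψ ≤ Real.log q := by
  intro q _ ψ hne
  have hq3 : 3 ≤ q := by
    by_contra hlt
    push Not at hlt
    have h0 : q ≠ 0 := NeZero.ne q
    have htot : Nat.totient q ≤ 1 := by
      interval_cases q <;> decide
    have hcard : Fintype.card (ZMod q)ˣ ≤ 1 := by rw [ZMod.card_units_eq_totient]; exact htot
    haveI : Subsingleton (ZMod q)ˣ := Fintype.card_le_one_iff_subsingleton.mp hcard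
    apply hne
    refine MulChar.ext (fun u => ?_)
    rw [Subsingleton.elim u 1]
    simp
  have hq3r : (3 : ℝ) ≤ q := by exact_mod_cast hq3
  have hlog : 1 < Real.log (q : ℝ) := lt_of_lt_of_le one_lt_log_three (Real.log_le_log (by norm_num) hq3r)
  have hle : (world D χ).LOne q ψ ≤ 1 := by
    rw [world_LOne]
    split_ifs
    · exact lam_le_one hL
    · exact le_rfl
  linarith

/-- **Row dhE-12 on the world (the exceptional-zero package at `(D, χ)`)** with `β₁ = betaExc D`: window
`DHMenuLines.window`, multiplicity one, `χ² = 1`, uniqueness among ALL slots `(D, ψ)` (a real zero `> ½` is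
`β₁` on an induced slot, and an induced slot at level `D` is `χ`), `0.72(1 − β₁) ≤ λ`, `1 − β₁ = δ <
(25/18)(log D)⁻²⁰²²`. [cite: Zhang2022LandauSiegel, Lemma 5.5] [cite: BenliGoelTwissZaman2025, Lemma 2.9] -/
theorem world_row12 (hquad : χ.IsQuadratic) :
    (world D χ).LOne D χ < 1 / Real.log D ^ 2022 → 400000 < D →
    ∃ β₁ : ℝ, 1 - 1 / (10 * Real.log D) < β₁ ∧ β₁ < 1 ∧ (world D χ).mult D χ β₁ = 1 ∧ χ ^ 2 = 1 ∧
      (∀ (ψ : DirichletCharacter ℂ D) (β : ℝ), 1 - 1 / (10 * Real.log D) < β → β < 1 →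
          (world D χ).IsZero D ψ β → ψ = χ ∧ β = β₁) ∧
      0.72 * (1 - β₁) ≤ (world D χ).LOne D χ ∧ 1 - β₁ < 25 / 18 / Real.log D ^ 2022 := by
  intro _ _
  haveI : NeZero D := ⟨by have := three_le_of_hL hL; omega⟩
  refine ⟨betaExc D, (betaExc_window hL).1, (betaExc_window hL).2, mult_self_betaExc hL, hquad.sq_eq_one,
    ?_, ?_, ?_⟩
  · intro ψ β hlo _ hz
    obtain ⟨hs, hβ⟩ := real_zero_gt_half hL hz (half_lt_of_window (three_le_of_hL hL) hlo)
    exact ⟨hs.eq_self, hβ⟩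
  · rw [world_LOne, if_pos isExcSlot_self]
    have h43 : (1 : ℝ) ≤ 0.24 * Real.log D ^ 2 := by nlinarith
    exact (lemma29_sides_at_world (log_pos_of_hL hL) h43).1
  · rw [one_sub_betaExc, DHMenuLines.delta]
    have hp : 0 < Real.log (D : ℝ) ^ 2022 := pow_pos (log_pos_of_hL hL) _
    rw [div_lt_div_iff₀ (by positivity) hp]
    nlinarith

/-- **Row dhE-15 on the world (the `0.69/√q` floor for real primitive `ψ`)**: on induced slots
`0.69/√q ≤ 0.69 e^{−(log D)/2} < λ` (`floor069_lt_lam`), elsewhere `0.69/√q ≤ 0.69 < 1 = LOne`.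
[cite: MontgomeryVaughan2007, §4.3] -/
theorem world_row15 : ∀ (q : ℕ) [NeZero q], 3 ≤ q → ∀ ψ : DirichletCharacter ℂ q, ψ.IsPrimitive →
    ψ.IsQuadratic → (69 / 100) / Real.sqrt q ≤ (world D χ).LOne q ψ := by
  intro q _ hq ψ _ _
  have hq3 : (3 : ℝ) ≤ q := by exact_mod_cast hq
  have hsq1 : 1 ≤ Real.sqrt (q : ℝ) := by
    rw [show (1 : ℝ) = Real.sqrt 1 by simp]
    exact Real.sqrt_le_sqrt (by linarith)
  rw [world_LOne]
  split_ifs with hs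
  · have hD0 := cast_pos_of_hL hL
    set L := Real.log (D : ℝ) with hLdef
    have hsqrt : Real.exp (L / 2) ≤ Real.sqrt q := by
      rw [← sqrt_cast_eq_exp hL]; exact Real.sqrt_le_sqrt hs.cast_le
    have hE : 0 < Real.exp (L / 2) := Real.exp_pos _
    have hmono : (69 / 100) / Real.sqrt (q : ℝ) ≤ (69 / 100) / Real.exp (L / 2) :=
      div_le_div_of_nonneg_left (by norm_num) hE hsqrt
    have hF := DHMenuLines.floor069_lt_lam hL
    rw [Real.exp_neg, ← div_eq_mul_inv] at hF
    rw [lam_eq_lines]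
    linarith
  · have : (69 / 100) / Real.sqrt (q : ℝ) ≤ 69 / 100 := div_le_self (by norm_num) hsq1
    linarith

/-- **Row dhE-19 on the world (LLS 2015 under GRH): INERT** — the GRH hypothesis read over the world fails at
the zero `β₁(D)` of the slot `(D, χ)`, `Re β₁ > ½`. [cite: LamzouriLiSoundararajan2015, Theorem 1.5 p. 2393] -/
theorem world_row19 :
    (∀ (q : ℕ) (ψ : DirichletCharacter ℂ q) (ρ : ℂ), (world D χ).IsZero q ψ ρ → ρ.re = 1 / 2) →
    ∀ (q : ℕ) [NeZero q] (ψ : DirichletCharacter ℂ q), ψ.IsPrimitive → (10 : ℝ) ^ 10 ≤ (q : ℝ) →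
      (world D χ).LOne q ψ ≤ 2 * Real.exp Real.eulerMascheroniConstant * LamzouriLiSoundararajan2015.upperBracket q ∧
        1 / (world D χ).LOne q ψ ≤
          12 * Real.exp Real.eulerMascheroniConstant / Real.pi ^ 2 * LamzouriLiSoundararajan2015.lowerBracket q := by
  intro hGRH
  exfalso
  have hz : (world D χ).IsZero D χ ((betaExc D : ℝ) : ℂ) := by
    unfold ZeroWorld.IsZero; rw [mult_self_betaExc hL]; exact Nat.one_pos
  have h := hGRH D χ _ hz
  rw [Complex.ofReal_re] at h
  linarith [half_lt_betaExc hL]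

/-- **Row S3 on the world (structure of the value field)**: `LOne > 0`, `LOne(ψ̄) = LOne(ψ)` (induced slots are
stable under inversion since `χ̄ = χ`), `Lhalf ≥ 0`. [cite: MontgomeryVaughan2007, §4.3] -/
theorem world_rowS3 (hquad : χ.IsQuadratic) : ∀ (q : ℕ) [NeZero q] (ψ : DirichletCharacter ℂ q),
    (ψ ≠ 1 → 0 < (world D χ).LOne q ψ) ∧ (world D χ).LOne q ψ⁻¹ = (world D χ).LOne q ψ ∧
      ∀ t : ℝ, 0 ≤ (world D χ).Lhalf q ψ t := by
  intro q _ ψ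
  refine ⟨fun _ => ?_, ?_, fun t => by rw [world_Lhalf]; norm_num⟩
  · rw [world_LOne]
    split_ifs
    · exact lam_pos_of_hL hL
    · norm_num
  · rw [world_LOne, world_LOne]
    by_cases hs : IsExcSlot D χ q ψ
    · rw [if_pos hs, if_pos ((isExcSlot_inv_iff hquad).mpr hs)]
    · rw [if_neg hs, if_neg (fun h => hs ((isExcSlot_inv_iff hquad).mp h))]

end World

end Literature.NumberTheory.LFunctions.Zhang2022.DH

end
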